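import Summits.RiemannHypothesis.RiemannHypothesis.Theorems.SuzukiWindowsDoorDirichletSymbol

/-!
# SuzukiWindowsDoorCoeffPrimePower — the prime-power law `λ_θ(p^k) = Σ_{j=1}^{k} C(k−1,j−1) (2θ log p)ʲ/j!` of the Ihara–Matsumoto coefficients (column DBR; RH-FREE)

RH-FREE throughout; nothing here bears on the truth of RH.  Companion of `SuzukiWindowsDoorDirichletSymbol`
([Su20] (1.10) in the kernel) and `SuzukiWindowsDoorWindowIdentity` ([Su20] (1.12) in the kernel): the PRIME-POWER
CLAUSE of the column's typed target `LimCoeffPrimePowerLaw` (theory's P1f, HOME/rh-dbr-theory/lean/SuzukiCanonicalWindow.lean)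
for the tree's coefficients `limCoeff θ n = λ_θ(n) = Σ_{j ≤ Ω(n)} (2θ)ʲ/j! Λ^{∗j}(n)` — the formula by which BOTH engine
lineages of the DBR column tabulate `λ_θ` on prime powers (DATA/code/et1c/linA/lineageA.py: «lambda(p^k) =
sum_j C(k-1,j-1) (2 th log p)^j / j!»):

* §1 the convolution powers on prime powers: `Λ^{∗j}(p^k) = C(k−1, j−1) (log p)ʲ` for `j, k ≥ 1`
  (compositions of `k` into `j` positive parts), via `Λ^{∗(j+1)}(p^k) = log p · Σ_{i<k} Λ^{∗j}(p^i)` and Pascal's rule;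
* §2 **`limCoeff_prime_pow`**: `λ_θ(p^k) = Σ_{j=1}^{k} C(k−1,j−1) (2θ log p)ʲ/j!` (`k ≥ 1`), with the instances
  `λ_θ(p) = 2θ log p` (also in the window-identity file) and `λ_θ(p²) = 2θ log p + (2θ log p)²/2`, and `λ_θ(0) = 0`.

The multiplicativity clause of `LimCoeffPrimePowerLaw` (`λ_θ(mn) = λ_θ(m)λ_θ(n)` for coprime `m, n`) is NOT in this file.

References: [Su20] M. Suzuki, ASPM 84 (2020) 399–411 = arXiv:1907.07302, §1 (1.10) (Ihara–Matsumoto coefficients;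
generating function `exp(aT/(1−T))`, `a = 2θ log p`).
-/

noncomputable section

-- D-0017: `Summit.<S>.<S>.…` is the designed namespace of a single-problem summit.
set_option linter.dupNamespace false

open Filter Topology Finset

namespace Summit.RiemannHypothesis.RiemannHypothesis.Theorems.SuzukiWindowsDoorCoeffPrimePower

open Literature.NumberTheory.LFunctions
open scoped ArithmeticFunction.vonMangoldt ArithmeticFunction.Omega Nat
open ArithmeticFunction (mul_apply one_apply cardFactors_apply_prime_pow vonMangoldt_apply_pow
  vonMangoldt_apply_prime vonMangoldt_apply_one)
open SuzukiWindowsDoorDirichletSymbol (vonMangoldt_pow_apply_eq_zero vonMangoldt_pow_nonneg)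

/-! ## §1 `Λ^{∗j}` on prime powers -/

/-- RH-FREE.  `Λ^{∗j}(1) = 0` for `j ≥ 1` (`Ω(1) = 0 < j`). -/
theorem vonMangoldt_pow_apply_one {j : ℕ} (hj : 1 ≤ j) : (Λ ^ j) 1 = 0 :=
  vonMangoldt_pow_apply_eq_zero (by rw [ArithmeticFunction.cardFactors_one]; omega)

/-- RH-FREE.  The recursion on prime powers: `Λ^{∗(j+1)}(p^k) = log p · Σ_{i<k} Λ^{∗j}(p^i)`
(the divisors of `p^k` are the `p^i`, and `Λ(p^{k−i}) = log p` for `i < k`, `Λ(1) = 0`). -/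
theorem vonMangoldt_pow_succ_prime_pow {p : ℕ} (hp : p.Prime) (j k : ℕ) :
    (Λ ^ (j + 1)) (p ^ k) = Real.log p * ∑ i ∈ range k, (Λ ^ j) (p ^ i) := by
  rw [pow_succ, mul_apply,
    Nat.sum_divisorsAntidiagonal (f := fun a b => (Λ ^ j) a * Λ b) (n := p ^ k),
    Nat.sum_divisors_prime_pow hp, sum_range_succ, mul_sum]
  have hlast : (Λ ^ j) (p ^ k) * Λ (p ^ k / p ^ k) = 0 := by
    rw [Nat.div_self (pow_pos hp.pos k), vonMangoldt_apply_one, mul_zero]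
  rw [hlast, add_zero]
  refine sum_congr rfl fun i hi => ?_
  rw [mem_range] at hi
  rw [Nat.pow_div hi.le hp.pos, vonMangoldt_apply_pow (by omega), vonMangoldt_apply_prime hp, mul_comm]

/-- RH-FREE.  Partial sums along prime powers: for `j ≥ 1` and every `k`,
`Σ_{i<k} Λ^{∗j}(p^i) = C(k−1, j) (log p)ʲ` provided `Λ^{∗j}(p^i) = C(i−1, j−1)(log p)ʲ` for `1 ≤ i < k`
(Pascal's rule; the `i = 0` term vanishes). -/
theorem sum_range_vonMangoldt_pow_prime_pow {p : ℕ} {j : ℕ} (hj : 1 ≤ j) {k : ℕ}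
    (h : ∀ i : ℕ, 1 ≤ i → i < k → (Λ ^ j) (p ^ i) = ((i - 1).choose (j - 1) : ℝ) * Real.log p ^ j) :
    ∑ i ∈ range k, (Λ ^ j) (p ^ i) = ((k - 1).choose j : ℝ) * Real.log p ^ j := by
  induction k with
  | zero =>
    rw [sum_range_zero, show (0 : ℕ) - 1 = 0 by rfl, Nat.choose_eq_zero_of_lt (by omega)]
    simp
  | succ k ih =>
    rw [sum_range_succ, ih fun i hi hik => h i hi (by omega)]
    rcases Nat.eq_zero_or_pos k with rfl | hk
    · rw [pow_zero, vonMangoldt_pow_apply_one hj]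
      simp
    · have hP : ((k + 1 - 1).choose j : ℝ) = ((k - 1).choose j : ℝ) + ((k - 1).choose (j - 1) : ℝ) := by
        rw [show k + 1 - 1 = (k - 1) + 1 by omega]
        conv_lhs => rw [show j = (j - 1) + 1 by omega, Nat.choose_succ_succ]
        rw [Nat.succ_eq_add_one, Nat.sub_add_cancel hj]
        push_cast
        ring
      rw [h k hk (lt_add_one k), hP]
      ring

/-- RH-FREE.  **`Λ^{∗j}` on prime powers**: for `j ≥ 1`, `k ≥ 1` and `p` prime,
`Λ^{∗j}(p^k) = C(k−1, j−1) (log p)ʲ` — the number of compositions of `k` into `j` positive parts times `(log p)ʲ`. -/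
theorem vonMangoldt_pow_prime_pow {p : ℕ} (hp : p.Prime) {j : ℕ} (hj : 1 ≤ j) {k : ℕ} (hk : 1 ≤ k) :
    (Λ ^ j) (p ^ k) = ((k - 1).choose (j - 1) : ℝ) * Real.log p ^ j := by
  induction j, hj using Nat.le_induction generalizing k with
  | base =>
    rw [pow_one, vonMangoldt_apply_pow (by omega), vonMangoldt_apply_prime hp]
    simp
  | succ j hj ih =>
    rw [vonMangoldt_pow_succ_prime_pow hp, sum_range_vonMangoldt_pow_prime_pow hj fun i hi _ => ih hi,
      show j + 1 - 1 = j by omega]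
    ring

/-! ## §2 The prime-power law for `λ_θ` -/

/-- RH-FREE.  `λ_θ(0) = 0` (junk value; every `Λ^{∗j}(0) = 0`). -/
theorem limCoeff_zero (θ : ℝ) : limCoeff θ 0 = 0 := by
  unfold limCoeff
  exact sum_eq_zero fun j _ => by rw [ArithmeticFunction.map_zero, mul_zero]

/-- RH-FREE.  **THE PRIME-POWER LAW [Su20] (1.10)** (prime-power clause of the column's `LimCoeffPrimePowerLaw`):
for `p` prime and `k ≥ 1`, `λ_θ(p^k) = Σ_{j=1}^{k} C(k−1, j−1) (2θ log p)ʲ / j!`. -/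
theorem limCoeff_prime_pow (θ : ℝ) {p k : ℕ} (hp : p.Prime) (hk : 1 ≤ k) :
    limCoeff θ (p ^ k) =
      ∑ j ∈ Icc 1 k, (Nat.choose (k - 1) (j - 1) : ℝ) * (2 * θ * Real.log (p : ℝ)) ^ j / (j.factorial : ℝ) := by
  have hne : p ^ k ≠ 1 := (Nat.one_lt_pow (by omega) hp.one_lt).ne'
  unfold limCoeff
  rw [cardFactors_apply_prime_pow hp, sum_range_succ']
  simp only [pow_zero, Nat.factorial_zero, Nat.cast_one, div_one, one_mul, one_apply, hne, ↓reduceIte,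
    add_zero]
  rw [← Finset.Ico_add_one_right_eq_Icc, sum_Ico_eq_sum_range, show k + 1 - 1 = k by omega]
  refine sum_congr rfl fun j _ => ?_
  rw [vonMangoldt_pow_prime_pow hp (by omega) hk, Nat.add_sub_cancel, Nat.add_sub_cancel_left, add_comm 1 j]
  ring

/-- RH-FREE.  Instance `k = 1`: `λ_θ(p) = 2θ log p`. -/
theorem limCoeff_prime_pow_one (θ : ℝ) {p : ℕ} (hp : p.Prime) : limCoeff θ (p ^ 1) = 2 * θ * Real.log p := by
  rw [limCoeff_prime_pow θ hp le_rfl, Finset.Icc_self, sum_singleton]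
  simp

/-- RH-FREE.  Instance `k = 2`: `λ_θ(p²) = 2θ log p + (2θ log p)²/2` (the first power where `j = 2` compositions enter). -/
theorem limCoeff_prime_sq (θ : ℝ) {p : ℕ} (hp : p.Prime) :
    limCoeff θ (p ^ 2) = 2 * θ * Real.log p + (2 * θ * Real.log p) ^ 2 / 2 := by
  rw [limCoeff_prime_pow θ hp (by norm_num), ← Finset.Ico_add_one_right_eq_Icc, sum_Ico_eq_sum_range]
  simp [sum_range_succ]

end Summit.RiemannHypothesis.RiemannHypothesis.Theorems.SuzukiWindowsDoorCoeffPrimePower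

end
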